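import Mathlib
import HarnessLib
import Summits.HubbardSuperconductivity.HubbardSuperconductivity.Theorems.KLProgrammeKLRegimeTwoVolumeTowerStepCovZeroIncrSymbol

/-!
# K3 VL child `KLRegimeVolumeLimitV17F2` (stmt-HubbardSuperconductivity-20440), located item «SCALE-0-STEPCOV», part 3c (INCREMENT `ℓ¹`, SECTIONAL): the
# ISOTROPIC moment-weighted FIXED-TIME `ℓ¹` norm of the slice-kernel INCREMENT `(βV²)⁻²·(Ψ̂_{(Λ₂,Λ₁]}[K′] − Ψ̂_{(Λ₂,Λ₁]}[K])` of one flow piece `(G₀, x)`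
# is `≤ C_f(K₃ˢ)·G₀/x` at the spatial rate `r_f(K₃ˢ)/x` (ε-free) — the decaying currency of the sectional frame telescope at scale `0`

Cell `gate-hubbard-kl`, seat p3 (g17).  With part 1's reduction `secRowWt_klStepCov_zero_sub_le` this bounds the sectional rows of one piece
`klStepCov[K_{i+1}] 0 − klStepCov[K_i] 0` of the telescope by `2·C_f·G₀·4^{−i}` whenever the weight rate is `≤ s_f·4^{−i}` (part 4).

* **`incrSlice_wt_sectional_le (K₃ˢ)`** — `∃ C_f, s_f > 0` (`r_f ≤ 1`) such that on any lattice, for any two `FrameOK` frames `K, K′`, any two-scale jet class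
  `0 ≤ G₀ ≤ 1 ≤ x` of the band increment with `‖D³e_K‖ ≤ K₃ˢx`, and `klBetaMin ≤ β`, at EVERY time difference `z₁`:
  `Σ_{z₂} (1 + (s_f/x)|z̃₂,₁| + (s_f/x)|z̃₂,₂|)·‖Σ_q χ_{q₁}(z₁)χ_{q₂}(z₂) • (βV²)⁻²ΨΔ(q)‖ ≤ C_f·(G₀/x)`.
  Proof: as part 2c (k3c3-p2's `sliceCharSumWt_sectional_le_of_mixed_data` with the increment as the «multiplier», `Ψ := 1`, `v = e₂`, `R₀ = 0`), with
  part 3a's increment data (orders three and two), amplitude `A₀ = D₁G₀/(βV²Λ₂²x²)`, rate `r_f/x`; time support `≤ β(Λ₁/π + 3/128)`, spatial support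
  `≤ 2(1793Λ₁+704)V²` (union of the two frames' closed shells); weight factor `≤ x·√C_W′`: β and V cancel and `x·x⁻² = x⁻¹`.

Everything is proved; no definitions, no sorry.  Nothing asserts any stub, K3, VL or superconductivity.
[cite: BenfattoGiulianiMastropietro2006, Lemma 2.2 (2.52)–(2.55), §2.8 (2.81), §3 (3.2)–(3.8)]
-/

noncomputable section

namespace Summit.HubbardSuperconductivity.HubbardSuperconductivity.Theorems.TorusFourierL2

set_option linter.dupNamespace false -- summit = problem name (single-conjunct summit), D-0017

open Set Finset Literature.MathematicalPhysics.QuantumLattice Literature.MathematicalPhysics.QuantumLattice.BandSectorCounting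
open Literature.MathematicalPhysics.QuantumLattice.FermiRG Literature.Probability.LatticeModels Literature.Analysis.SpecialFunctions
open Summit.HubbardSuperconductivity.HubbardSuperconductivity.Theorems.DispersionFlow
open Summit.HubbardSuperconductivity.HubbardSuperconductivity.Theorems.KLRegimeSplit
open Summit.HubbardSuperconductivity.HubbardSuperconductivity.Theorems.KLProgrammeLegKernels
open Summit.HubbardSuperconductivity.HubbardSuperconductivity.Theorems.PerturbedFermiCurve
open Summit.HubbardSuperconductivity.HubbardSuperconductivity.Theorems.KLRegimeWick
open Summit.HubbardSuperconductivity.HubbardSuperconductivity.Theorems.TwoVolumeSource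
open scoped Real Nat

open Classical

section IncrSectional

set_option maxHeartbeats 4000000 in -- explicit-constant bookkeeping against the large sectional master lemma
/-- **THE SECTIONAL ISOTROPIC WEIGHTED `ℓ¹` BOUND OF ONE FLOW-PIECE INCREMENT OF THE PLAIN SLICE KERNEL** (ε-free; see the module docstring).
[cite: BenfattoGiulianiMastropietro2006, Lemma 2.2 (2.52)–(2.55), §2.8 (2.81), §3 (3.2)–(3.8)] -/
theorem incrSlice_wt_sectional_le (K₃s : ℝ) (hK₃s : 0 ≤ K₃s) :
    ∃ Cf rf : ℝ, 0 < Cf ∧ 0 < rf ∧ rf ≤ 1 ∧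
      ∀ (V M : ℕ) [NeZero V] [NeZero M] (R : RenConsts) (U : ℝ) (N : ℕ) (R' : RenConsts) (U' : ℝ) (N' : ℕ) (μ : ℝ) (K K' : TrigPolyC4v),
      FrameOK R U N μ K → FrameOK R' U' N' μ K' →
      ∀ (G₀ x : ℝ), 0 ≤ G₀ → G₀ ≤ 1 → 1 ≤ x →
      (∀ p, ‖iteratedFDeriv ℝ 3 (frameLevel μ K) p‖ ≤ K₃s * x) →
      (∀ p, |frameLevel μ K' p - frameLevel μ K p| ≤ G₀ / x ^ 2) →
      (∀ p, ‖fderiv ℝ (fun p => frameLevel μ K' p - frameLevel μ K p) p‖ ≤ G₀ / x) →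
      (∀ p, ‖iteratedFDeriv ℝ 2 (fun p => frameLevel μ K' p - frameLevel μ K p) p‖ ≤ G₀) →
      (∀ p, ‖iteratedFDeriv ℝ 3 (fun p => frameLevel μ K' p - frameLevel μ K p) p‖ ≤ G₀ * x) →
      ∀ β : ℝ, klBetaMin ≤ β →
        ∀ z₁ : TorusSite 1 (2 * M), ∑ z₂ : TorusSite 2 V,
          (1 + rf / x * |(((z₂ 0).valMinAbs : ℤ) : ℝ)| + rf / x * |(((z₂ 1).valMinAbs : ℤ) : ℝ)|) *
            ‖∑ q : TorusSite 1 (2 * M) × TorusSite 2 V, (torusChar q.1 z₁ * torusChar q.2 z₂) •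
              ((((1 / (β * (V : ℝ) ^ 2) : ℝ) : ℂ) ^ 2 *
                (sliceSymbolFnXi (β * (V : ℝ) ^ 2) 0 (klScale klE0 2) (klScale klE0 1) (matsubaraFreq β M ⟨(q.1 0).val, ZMod.val_lt (q.1 0)⟩)
                    (nambuXiCT V μ K' q.2) -
                  sliceSymbolFnXi (β * (V : ℝ) ^ 2) 0 (klScale klE0 2) (klScale klE0 1) (matsubaraFreq β M ⟨(q.1 0).val, ZMod.val_lt (q.1 0)⟩)
                    (nambuXiCT V μ K q.2))))‖ ≤ Cf * (G₀ / x) := by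
  -- the cutoff numerals and the slice constants
  set D₁ : ℝ := 16 * (32 / 3 : ℝ) + 16 with hD₁
  set D₂ : ℝ := 32 * (448 / 3 * Real.exp 2) + 144 * (32 / 3 : ℝ) + 128 with hD₂
  set D₃ : ℝ := 64 * (44900 : ℝ) + 480 * (448 / 3 * Real.exp 2) + 1728 * (32 / 3 : ℝ) + 1536 with hD₃
  set D₄ : ℝ := 128 * (3960000 : ℝ) + 1408 * 44900 + 7776 * (448 / 3 * Real.exp 2) + 27648 * (32 / 3 : ℝ) + 24576 with hD₄
  have hD₁0 : 0 < D₁ := by rw [hD₁]; norm_num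
  have hD₁1 : 1 ≤ D₁ := by rw [hD₁]; norm_num
  have hD₂0 : 0 < D₂ := by rw [hD₂]; positivity
  have hD₃0 : 0 < D₃ := by rw [hD₃]; positivity
  have hD₄0 : 0 < D₄ := by rw [hD₄]; positivity
  have he : (0 : ℝ) < klE0 := by norm_num [klE0]
  set Λ₂ : ℝ := klScale klE0 2 with hΛ₂def
  set Λ₁ : ℝ := klScale klE0 1 with hΛ₁def
  have hΛ2 : 0 < Λ₂ := klth_klScale_pos 2
  have hΛ1 : 0 < Λ₁ := klth_klScale_pos 1
  have hΛ21 : Λ₂ ≤ Λ₁ := EngineV8.klScale_le_klScale he.le (by norm_num)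
  have hΛ1t : Λ₁ < 3 / 80 := klScale_klE0_lt_tube 1
  have hΛ2t : Λ₂ < 3 / 80 := klScale_klE0_lt_tube 2
  have hΛ2sq : Λ₂ ^ 2 ≤ 1 := by nlinarith
  have hπ := Real.pi_pos
  -- the jet polynomials of part 3a and the spatial rate
  set Y₂ : ℝ := 64 * D₃ / Λ₂ ^ 4 + 23 * D₂ / Λ₂ ^ 3 + D₁ / Λ₂ ^ 2 with hY₂
  set Y₃ : ℝ := 512 * D₄ / Λ₂ ^ 5 + 361 * D₃ / Λ₂ ^ 4 + (45 + (K₃s + 1)) * D₂ / Λ₂ ^ 3 + D₁ / Λ₂ ^ 2 with hY₃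
  set Y : ℝ := Y₂ + Y₃ with hY
  have hY₂0 : 0 ≤ Y₂ := by rw [hY₂]; positivity
  have hY₃0 : 0 ≤ Y₃ := by rw [hY₃]; positivity
  have hY0 : 0 ≤ Y := by rw [hY]; positivity
  set rf : ℝ := 1 / (2 * π * (1 + Y)) with hrf
  have hrf0 : 0 < rf := by rw [hrf]; positivity
  have hrf1 : rf ≤ 1 := by
    rw [hrf, div_le_one (by positivity)]
    nlinarith [Real.pi_gt_three]
  set CW' : ℝ := 524288 * ((1 : ℝ) + 1) *
      ((1 + 4 * Real.sqrt 2) ^ 2 * ((2 * Real.sqrt 2 / rf + 2) * (2 * Real.sqrt 2 / rf + 2)) + (1 / rf + 1) ^ 2) with hCW'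
  have hCW'0 : 0 < CW' := by rw [hCW']; positivity
  refine ⟨(Λ₁ / π + 3 / 128) * (Real.sqrt CW' * Real.sqrt (48 * (1793 * Λ₁ + 704)) * (D₁ / Λ₂ ^ 2)), rf, by positivity, hrf0, hrf1, ?_⟩
  intro V M _ _ R U N R' U' N' μ K K' hK hK' G₀ x hG hG1 hx hK3 hv₀ hv₁ hv₂ hv₃ β hβmin z₁
  -- the instance
  have hβ0 : 0 < β := pos_of_klBetaMin_le hβmin
  have hβ128 : (128 : ℝ) ≤ β := by simpa [klBetaMin] using hβmin
  have hV1 : (1 : ℝ) ≤ V := by exact_mod_cast Nat.pos_of_ne_zero (NeZero.ne V)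
  have hV0 : (0 : ℝ) < V := by linarith
  have hc : 0 < β * (V : ℝ) ^ 2 := by positivity
  have hx0 : 0 < x := by linarith
  obtain ⟨hre, hrn, hrv, hv⟩ := unitDirs_sq
  -- abbreviations
  set c₀ : ℂ := (((1 / (β * (V : ℝ) ^ 2) : ℝ) : ℂ)) ^ 2 with hc₀def
  set Ψ : TorusSite 1 (2 * M) × TorusSite 2 V → ℂ := fun q =>
    sliceSymbolFnXi (β * (V : ℝ) ^ 2) 0 Λ₂ Λ₁ (matsubaraFreq β M ⟨(q.1 0).val, ZMod.val_lt (q.1 0)⟩) (nambuXiCT V μ K' q.2) -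
      sliceSymbolFnXi (β * (V : ℝ) ^ 2) 0 Λ₂ Λ₁ (matsubaraFreq β M ⟨(q.1 0).val, ZMod.val_lt (q.1 0)⟩) (nambuXiCT V μ K q.2) with hΨdef
  set A₀ : ℝ := (1 / (β * (V : ℝ) ^ 2)) ^ 2 * (D₁ * (β * (V : ℝ) ^ 2) / Λ₂ ^ 2 * (G₀ / x ^ 2)) with hA₀def
  have hA₀0 : 0 ≤ A₀ := by positivity
  have hA₀eq : A₀ = D₁ * G₀ / (β * (V : ℝ) ^ 2 * Λ₂ ^ 2 * x ^ 2) := by rw [hA₀def]; field_simp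
  set s₁ : ℝ := rf / x with hs₁def
  have hs₁0 : 0 < s₁ := by positivity
  -- (a) sup
  have hsup : ∀ q, ‖c₀ * Ψ q‖ ≤ A₀ := fun q => by
    have h := incrSymbol_sup_le (V := V) (M := M) (μ := μ) (K := K) (K' := K') hβ0 hv₀ q
    rw [← hD₁] at h
    exact h
  -- (b) rate identities
  have hsV3 : (4 / (s₁ * V)) ^ 3 = (2 * π / V) ^ 3 * (64 * (1 + Y) ^ 3 * x ^ 3) := by
    rw [hs₁def, hrf]; field_simp; ring
  have hsV2 : (4 / (s₁ * V)) ^ 2 = (2 * π / V) ^ 2 * (16 * (1 + Y) ^ 2 * x ^ 2) := by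
    rw [hs₁def, hrf]; field_simp; ring
  have key3 : Y₃ * Λ₂ ^ 2 ≤ 64 * D₁ * (1 + Y) ^ 3 := by
    have h1 : Y₃ * Λ₂ ^ 2 ≤ Y₃ := mul_le_of_le_one_right hY₃0 hΛ2sq
    have h2 : Y₃ ≤ 1 + Y := by rw [hY]; linarith
    have h3 : (1 : ℝ) ≤ 1 + Y := by linarith
    have h4 : 1 + Y ≤ (1 + Y) ^ 3 := le_self_pow₀ h3 (by norm_num)
    have h5 : (1 + Y) ^ 3 ≤ 64 * D₁ * (1 + Y) ^ 3 := le_mul_of_one_le_left (by positivity) (by linarith)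
    linarith
  have key2 : Y₂ * Λ₂ ^ 2 ≤ 16 * D₁ * (1 + Y) ^ 2 := by
    have h1 : Y₂ * Λ₂ ^ 2 ≤ Y₂ := mul_le_of_le_one_right hY₂0 hΛ2sq
    have h2 : Y₂ ≤ 1 + Y := by rw [hY]; linarith
    have h3 : (1 : ℝ) ≤ 1 + Y := by linarith
    have h4 : 1 + Y ≤ (1 + Y) ^ 2 := le_self_pow₀ h3 (by norm_num)
    have h5 : (1 + Y) ^ 2 ≤ 16 * D₁ * (1 + Y) ^ 2 := le_mul_of_one_le_left (by positivity) (by linarith)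
    linarith
  -- (c) the spatial inputs (orders three and two)
  have hspace3 : ∀ r : Fin 2 → ℤ, (r 0 : ℝ) ^ 2 + (r 1 : ℝ) ^ 2 = 1 → ∀ q,
      ‖((fwdDiff ((0 : TorusSite 1 (2 * M)), (fun i => ((r i : ℤ) : ZMod V))))^[3] (fun y => c₀ * Ψ y)) q‖ ≤ A₀ * (4 / (s₁ * V)) ^ 3 := by
    intro r hr q
    refine (incrSymbol_three_space_le (V := V) (M := M) hK hβ0 hG hG1 hx hK₃s hK3 hv₀ hv₁ hv₂ hv₃ r hr q).trans ?_
    conv_rhs => rw [hA₀def, mul_assoc]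
    refine mul_le_mul_of_nonneg_left ?_ (by positivity)
    rw [← hD₄, ← hD₃, ← hD₂, ← hD₁, ← hΛ₂def, ← hY₃, hsV3]
    have h : β * (V : ℝ) ^ 2 * (2 * π / V) ^ 3 * (G₀ * x) * Y₃ =
        (β * (V : ℝ) ^ 2 * (2 * π / V) ^ 3 * (G₀ * x) / Λ₂ ^ 2) * (Y₃ * Λ₂ ^ 2) := by field_simp
    rw [h]
    have h' : D₁ * (β * (V : ℝ) ^ 2) / Λ₂ ^ 2 * (G₀ / x ^ 2) * ((2 * π / V) ^ 3 * (64 * (1 + Y) ^ 3 * x ^ 3)) =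
        (β * (V : ℝ) ^ 2 * (2 * π / V) ^ 3 * (G₀ * x) / Λ₂ ^ 2) * (64 * D₁ * (1 + Y) ^ 3) := by field_simp
    rw [h']
    exact mul_le_mul_of_nonneg_left key3 (by positivity)
  have hspace2 : ∀ r : Fin 2 → ℤ, (r 0 : ℝ) ^ 2 + (r 1 : ℝ) ^ 2 = 1 → ∀ q,
      ‖((fwdDiff ((0 : TorusSite 1 (2 * M)), (fun i => ((r i : ℤ) : ZMod V))))^[2] (fun y => c₀ * Ψ y)) q‖ ≤ A₀ * (4 / (s₁ * V)) ^ 2 := by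
    intro r hr q
    refine (incrSymbol_two_space_le (V := V) (M := M) hK hβ0 hG hG1 hx hv₀ hv₁ hv₂ r hr q).trans ?_
    conv_rhs => rw [hA₀def, mul_assoc]
    refine mul_le_mul_of_nonneg_left ?_ (by positivity)
    rw [← hD₃, ← hD₂, ← hD₁, ← hΛ₂def, ← hY₂, hsV2]
    have h : β * (V : ℝ) ^ 2 * (2 * π / V) ^ 2 * G₀ * Y₂ = (β * (V : ℝ) ^ 2 * (2 * π / V) ^ 2 * G₀ / Λ₂ ^ 2) * (Y₂ * Λ₂ ^ 2) := by
      field_simp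
    rw [h]
    have h' : D₁ * (β * (V : ℝ) ^ 2) / Λ₂ ^ 2 * (G₀ / x ^ 2) * ((2 * π / V) ^ 2 * (16 * (1 + Y) ^ 2 * x ^ 2)) =
        (β * (V : ℝ) ^ 2 * (2 * π / V) ^ 2 * G₀ / Λ₂ ^ 2) * (16 * D₁ * (1 + Y) ^ 2) := by field_simp
    rw [h']
    exact mul_le_mul_of_nonneg_left key2 (by positivity)
  -- (d) time and spatial support of the increment
  have hsuppT : ((univ : Finset (TorusSite 1 (2 * M))).filter fun q₁ => ∃ k, Ψ (q₁, k) ≠ 0).card ≤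
      ((univ : Finset (TorusSite 1 (2 * M))).filter fun q₁ => ∃ k, Ψ (q₁, k) ≠ 0).card := le_rfl
  have hNt : ((((univ : Finset (TorusSite 1 (2 * M))).filter fun q₁ => ∃ k, Ψ (q₁, k) ≠ 0).card : ℕ) : ℝ) ≤ β * (Λ₁ / π + 3 / 128) := by
    have hsub : ((univ : Finset (TorusSite 1 (2 * M))).filter fun q₁ => ∃ k, Ψ (q₁, k) ≠ 0) ⊆
        (univ : Finset (TorusSite 1 (2 * M))).filter fun q₁ =>
          (fun i : MatsubaraIdx M => |matsubaraFreq β M i| ≤ Λ₁) ⟨(q₁ 0).val, ZMod.val_lt (q₁ 0)⟩ := by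
      intro q₁ hq
      rw [mem_filter] at hq ⊢
      obtain ⟨k, hk⟩ := hq.2
      refine ⟨mem_univ _, ?_⟩
      by_contra hω
      apply hk
      simp only [hΨdef]
      rw [sliceSymbolFnXi_eq_zero_of_not_shell hΛ2 hΛ21 (fun h => hω h.1), sliceSymbolFnXi_eq_zero_of_not_shell hΛ2 hΛ21 (fun h => hω h.1), sub_zero]
    have h1 := (Finset.card_le_card hsub).trans (card_filter_timeTorus_le_card_filter (M := M) (fun i : MatsubaraIdx M => |matsubaraFreq β M i| ≤ Λ₁))
    have h2 : ((((univ : Finset (MatsubaraIdx M)).filter fun i => |matsubaraFreq β M i| ≤ Λ₁).card : ℕ) : ℝ) ≤ Λ₁ * β / π + 3 :=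
      card_filter_matsubaraFreq_le hβ0 hΛ1.le _ fun i hi => (mem_filter.1 hi).2
    refine le_trans (Nat.cast_le.2 h1) (h2.trans ?_)
    rw [mul_add]
    have : (3 : ℝ) ≤ β * (3 / 128) := by linarith
    have e : Λ₁ * β / π = β * (Λ₁ / π) := by ring
    linarith
  have hsuppS : ∀ q₁ : TorusSite 1 (2 * M), ((univ : Finset (TorusSite 2 V)).filter fun k => Ψ (q₁, k) ≠ 0).card ≤
      ((univ : Finset (TorusSite 2 V)).filter (fun k => |nambuXiCT V μ K' k| ≤ Λ₁) ∪
        (univ : Finset (TorusSite 2 V)).filter (fun k => |nambuXiCT V μ K k| ≤ Λ₁)).card := by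
    intro q₁
    refine Finset.card_le_card fun k hk => ?_
    rw [mem_filter] at hk
    rw [Finset.mem_union, mem_filter, mem_filter]
    by_cases h1 : |nambuXiCT V μ K' k| ≤ Λ₁
    · exact Or.inl ⟨mem_univ _, h1⟩
    · right
      refine ⟨mem_univ _, ?_⟩
      by_contra h2
      apply hk.2
      simp only [hΨdef]
      rw [sliceSymbolFnXi_eq_zero_of_not_shell hΛ2 hΛ21 (fun h => h1 h.2), sliceSymbolFnXi_eq_zero_of_not_shell hΛ2 hΛ21 (fun h => h2 h.2), sub_zero]
  have hNsp : ((((univ : Finset (TorusSite 2 V)).filter (fun k => |nambuXiCT V μ K' k| ≤ Λ₁) ∪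
      (univ : Finset (TorusSite 2 V)).filter (fun k => |nambuXiCT V μ K k| ≤ Λ₁)).card : ℕ) : ℝ) ≤ (V : ℝ) ^ 2 * (2 * (1793 * Λ₁ + 704)) := by
    have hA := card_frameLevel_le_le (L := V) hK' hΛ1.le hΛ1t
    have hB := card_frameLevel_le_le (L := V) hK hΛ1.le hΛ1t
    have hU := Finset.card_union_le ((univ : Finset (TorusSite 2 V)).filter (fun k => |nambuXiCT V μ K' k| ≤ Λ₁))
      ((univ : Finset (TorusSite 2 V)).filter (fun k => |nambuXiCT V μ K k| ≤ Λ₁))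
    have hVV : (V : ℝ) ≤ (V : ℝ) ^ 2 := le_self_pow₀ hV1 (by norm_num)
    have e : (V : ℝ) ^ 2 * (2 * (1793 * Λ₁ + 704)) = 2 * (1793 * Λ₁ * (V : ℝ) ^ 2 + 704 * (V : ℝ) ^ 2) := by ring
    rw [e]
    have := Nat.cast_le (α := ℝ) |>.2 hU
    push_cast at this
    linarith
  -- (e) the sectional master lemma with the increment as the «multiplier» and `1` as the «propagator»
  have hfun : (fun y : TorusSite 1 (2 * M) × TorusSite 2 V => c₀ * (Ψ y * (fun _ : TorusSite 1 (2 * M) × TorusSite 2 V => (1 : ℂ)) y)) =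
      fun y => c₀ * Ψ y := by
    funext y; simp only [mul_one]
  have h₁ : ∀ q (i : Fin 2), ‖((fwdDiff ((0 : TorusSite 1 (2 * M)), (Pi.single i (1 : ZMod V) : TorusSite 2 V)))^[3]
      (fun y : TorusSite 1 (2 * M) × TorusSite 2 V => c₀ * (Ψ y * (fun _ : TorusSite 1 (2 * M) × TorusSite 2 V => (1 : ℂ)) y))) q‖ ≤
      A₀ * (4 / (s₁ * V)) ^ 3 := fun q i => by
    rw [hfun, pi_single_zmod_eq_intCast V i]; exact hspace3 _ (hre i) q
  have h₂ : ∀ q, ‖((fwdDiff ((0 : TorusSite 1 (2 * M)), (fun j => (((![-(![0, 1] : Fin 2 → ℤ) 1, (![0, 1] : Fin 2 → ℤ) 0] : Fin 2 → ℤ) j : ℤ) : ZMod V))))^[3]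
      (fun y : TorusSite 1 (2 * M) × TorusSite 2 V => c₀ * (Ψ y * (fun _ : TorusSite 1 (2 * M) × TorusSite 2 V => (1 : ℂ)) y))) q‖ ≤
      A₀ * (4 / (s₁ * V)) ^ 3 := fun q => by
    rw [hfun]; exact hspace3 _ hrn q
  have h₃ : ∀ q, ‖((fwdDiff ((0 : TorusSite 1 (2 * M)), (fun j => (((![0, 1] : Fin 2 → ℤ) j : ℤ) : ZMod V))))^[2]
      (fun y : TorusSite 1 (2 * M) × TorusSite 2 V => c₀ * (Ψ y * (fun _ : TorusSite 1 (2 * M) × TorusSite 2 V => (1 : ℂ)) y))) q‖ ≤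
      A₀ * (4 / (s₁ * V)) ^ 2 := fun q => by
    rw [hfun]; exact hspace2 _ hrv q
  have h₃' : ∀ q, ‖((fwdDiff ((0 : TorusSite 1 (2 * M)), (fun j => (((![0, 1] : Fin 2 → ℤ) j : ℤ) : ZMod V))))^[3]
      (fun y : TorusSite 1 (2 * M) × TorusSite 2 V => c₀ * (Ψ y * (fun _ : TorusSite 1 (2 * M) × TorusSite 2 V => (1 : ℂ)) y))) q‖ ≤
      A₀ * (4 / (s₁ * V)) ^ 3 := fun q => by
    rw [hfun]; exact hspace3 _ hrv q
  have hsup' : ∀ q, ‖c₀ * (Ψ q * (fun _ : TorusSite 1 (2 * M) × TorusSite 2 V => (1 : ℂ)) q)‖ ≤ A₀ := fun q => by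
    simp only [mul_one]; exact hsup q
  have main := sliceCharSumWt_sectional_le_of_mixed_data c₀ Ψ (fun _ => (1 : ℂ)) (![0, 1] : Fin 2 → ℤ) hv (s₀ := 1) one_pos hs₁0 hs₁0 hs₁0 hs₁0
    (R₀ := 0) (by push_cast; rw [mul_zero]; exact_mod_cast Nat.pos_of_ne_zero (NeZero.ne V)) hA₀0 hsuppT hsuppS hsup' h₁ h₂ h₃ h₃' z₁
  simp only [mul_one] at main
  refine le_trans (le_of_eq ?_) (main.trans ?_)
  · rfl
  have hv0 : (((![0, 1] : Fin 2 → ℤ) 0 : ℤ) : ℝ) = 0 := by simp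
  have hv1 : (((![0, 1] : Fin 2 → ℤ) 1 : ℤ) : ℝ) = 1 := by simp
  rw [hv0, hv1]
  have hsq1 : Real.sqrt ((0 : ℝ) ^ 2 + (1 : ℝ) ^ 2) = 1 := by norm_num
  rw [hsq1]
  have es : 2 * Real.sqrt 2 * s₁ / (s₁ * 1) = 2 * Real.sqrt 2 := by field_simp
  rw [es, Nat.cast_zero, mul_zero, add_zero, div_one, div_one, mul_one]
  have e2 : (1 + 2 * Real.sqrt 2 + 2 * Real.sqrt 2) = 1 + 4 * Real.sqrt 2 := by ring
  rw [e2]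
  -- the weight factor: `1/s₁ = x/rf`, `x ≥ 1`
  have hW : 524288 * ((1 : ℝ) + 1) * ((1 + 4 * Real.sqrt 2) ^ 2 * ((2 * Real.sqrt 2 / s₁ + 2) * (2 * Real.sqrt 2 / s₁ + 2)) + (1 / s₁ + 1) ^ 2) ≤
      x ^ 2 * CW' := by
    rw [hCW']
    have ha : 2 * Real.sqrt 2 / s₁ + 2 ≤ x * (2 * Real.sqrt 2 / rf + 2) := by
      rw [hs₁def]
      have e : 2 * Real.sqrt 2 / (rf / x) = x * (2 * Real.sqrt 2 / rf) := by field_simp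
      rw [e, mul_add]; linarith
    have ha0 : 0 ≤ 2 * Real.sqrt 2 / s₁ + 2 := by positivity
    have hb : 1 / s₁ + 1 ≤ x * (1 / rf + 1) := by
      rw [hs₁def]
      have e : 1 / (rf / x) = x * (1 / rf) := by field_simp
      rw [e, mul_add]; linarith
    have hb0 : 0 ≤ 1 / s₁ + 1 := by positivity
    have hA : (2 * Real.sqrt 2 / s₁ + 2) * (2 * Real.sqrt 2 / s₁ + 2) ≤ x ^ 2 * ((2 * Real.sqrt 2 / rf + 2) * (2 * Real.sqrt 2 / rf + 2)) := by
      calc (2 * Real.sqrt 2 / s₁ + 2) * (2 * Real.sqrt 2 / s₁ + 2) ≤ (x * (2 * Real.sqrt 2 / rf + 2)) * (x * (2 * Real.sqrt 2 / rf + 2)) :=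
            mul_le_mul ha ha ha0 (by positivity)
        _ = _ := by ring
    have hB : (1 / s₁ + 1) ^ 2 ≤ x ^ 2 * (1 / rf + 1) ^ 2 := by
      calc (1 / s₁ + 1) ^ 2 ≤ (x * (1 / rf + 1)) ^ 2 := pow_le_pow_left₀ hb0 hb 2
        _ = _ := by ring
    have hBr : (1 + 4 * Real.sqrt 2) ^ 2 * ((2 * Real.sqrt 2 / s₁ + 2) * (2 * Real.sqrt 2 / s₁ + 2)) + (1 / s₁ + 1) ^ 2 ≤
        x ^ 2 * ((1 + 4 * Real.sqrt 2) ^ 2 * ((2 * Real.sqrt 2 / rf + 2) * (2 * Real.sqrt 2 / rf + 2)) + (1 / rf + 1) ^ 2) := by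
      calc (1 + 4 * Real.sqrt 2) ^ 2 * ((2 * Real.sqrt 2 / s₁ + 2) * (2 * Real.sqrt 2 / s₁ + 2)) + (1 / s₁ + 1) ^ 2
          ≤ (1 + 4 * Real.sqrt 2) ^ 2 * (x ^ 2 * ((2 * Real.sqrt 2 / rf + 2) * (2 * Real.sqrt 2 / rf + 2))) + x ^ 2 * (1 / rf + 1) ^ 2 :=
            add_le_add (mul_le_mul_of_nonneg_left hA (by positivity)) hB
        _ = _ := by ring
    calc 524288 * ((1 : ℝ) + 1) * ((1 + 4 * Real.sqrt 2) ^ 2 * ((2 * Real.sqrt 2 / s₁ + 2) * (2 * Real.sqrt 2 / s₁ + 2)) + (1 / s₁ + 1) ^ 2)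
        ≤ 524288 * ((1 : ℝ) + 1) * (x ^ 2 * ((1 + 4 * Real.sqrt 2) ^ 2 * ((2 * Real.sqrt 2 / rf + 2) * (2 * Real.sqrt 2 / rf + 2)) + (1 / rf + 1) ^ 2)) := by
          gcongr
      _ = _ := by ring
  have hWs : Real.sqrt (524288 * ((1 : ℝ) + 1) * ((1 + 4 * Real.sqrt 2) ^ 2 * ((2 * Real.sqrt 2 / s₁ + 2) * (2 * Real.sqrt 2 / s₁ + 2)) + (1 / s₁ + 1) ^ 2)) ≤
      x * Real.sqrt CW' := by
    have e : x * Real.sqrt CW' = Real.sqrt (x ^ 2 * CW') := by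
      rw [Real.sqrt_mul (by positivity) CW', Real.sqrt_sq hx0.le]
    rw [e]; exact Real.sqrt_le_sqrt hW
  have hNsq : Real.sqrt (24 * (V : ℝ) ^ 2 * ((((univ : Finset (TorusSite 2 V)).filter (fun k => |nambuXiCT V μ K' k| ≤ Λ₁) ∪
      (univ : Finset (TorusSite 2 V)).filter (fun k => |nambuXiCT V μ K k| ≤ Λ₁)).card : ℕ) : ℝ)) ≤ (V : ℝ) ^ 2 * Real.sqrt (48 * (1793 * Λ₁ + 704)) := by
    have e : Real.sqrt ((V : ℝ) ^ 4 * (48 * (1793 * Λ₁ + 704))) = (V : ℝ) ^ 2 * Real.sqrt (48 * (1793 * Λ₁ + 704)) := by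
      rw [show (V : ℝ) ^ 4 * (48 * (1793 * Λ₁ + 704)) = (((V : ℝ) ^ 2) ^ 2) * (48 * (1793 * Λ₁ + 704)) by ring,
        Real.sqrt_mul (by positivity) (48 * (1793 * Λ₁ + 704)), Real.sqrt_sq (by positivity)]
    rw [← e]; refine Real.sqrt_le_sqrt ?_
    have := mul_le_mul_of_nonneg_left hNsp (by positivity : (0 : ℝ) ≤ 24 * (V : ℝ) ^ 2)
    linarith
  calc ((((univ : Finset (TorusSite 1 (2 * M))).filter fun q₁ => ∃ k, Ψ (q₁, k) ≠ 0).card : ℕ) : ℝ) *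
        (Real.sqrt (524288 * ((1 : ℝ) + 1) * ((1 + 4 * Real.sqrt 2) ^ 2 * ((2 * Real.sqrt 2 / s₁ + 2) * (2 * Real.sqrt 2 / s₁ + 2)) + (1 / s₁ + 1) ^ 2)) *
          Real.sqrt (24 * (V : ℝ) ^ 2 * ((((univ : Finset (TorusSite 2 V)).filter (fun k => |nambuXiCT V μ K' k| ≤ Λ₁) ∪
            (univ : Finset (TorusSite 2 V)).filter (fun k => |nambuXiCT V μ K k| ≤ Λ₁)).card : ℕ) : ℝ)) * A₀)
      ≤ (β * (Λ₁ / π + 3 / 128)) * ((x * Real.sqrt CW') * ((V : ℝ) ^ 2 * Real.sqrt (48 * (1793 * Λ₁ + 704))) * A₀) := by gcongr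
    _ = (Λ₁ / π + 3 / 128) * (Real.sqrt CW' * Real.sqrt (48 * (1793 * Λ₁ + 704)) * (D₁ / Λ₂ ^ 2)) * (G₀ / x) := by
        rw [hA₀eq]; field_simp

end IncrSectional

end Summit.HubbardSuperconductivity.HubbardSuperconductivity.Theorems.TorusFourierL2

end
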